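import Literature.Analysis.SpecialFunctions.RiemannThetaNonvanishing
import Mathlib.Analysis.Normed.Ring.InfiniteSum
import HarnessLib

/-!
# Theta functions of level three and the cubic product formula

For `Ω` symmetric with `Im Ω ≥ c > 0` and the Riemann theta function
`ϑ(z) = ϑ(z, Ω) = Σ_m exp(πi ᵗmΩm + 2πi ᵗm z)` (`RiemannTheta.lean`), the `3^g` **theta functions of
level three**
`f_c(z) = e^{2πi ᵗc z} ϑ(3z + Ωc, 3Ω) = Σ_{q ∈ ℤ^g} exp(πi(3 ᵗqΩq + 2 ᵗqΩc) + 2πi ᵗ(3q + c) z)`,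
`c ∈ {0, 1, 2}^g` (the classical basis `ϑ[c/3, 0](3z, 3Ω)` of `H⁰(L³)` up to the constants
`e^{πi ᵗcΩc/3}`; Mumford, *Tata Lectures on Theta I*, Ch. II §1, pp. 122–124; Lange–Birkenhake,
*Complex Abelian Varieties*, §3.2 and Remark 8.5.3) satisfy the **cubic product formula**

  `ϑ(z + a) ϑ(z + b) ϑ(z - a - b) = Σ_c Λ_c(a, b) · f_c(z)`,
  `Λ_c(a, b) = Σ_{u, v ∈ ℤ^g} T_a(c - u - v) T_b(u) T_{-a-b}(v)`,  `T_ζ(m) = exp(πi ᵗmΩm + 2πi ᵗm ζ)`,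

expressing every product of three translates of `ϑ` with translation vectors summing to zero — a
theta function for the factor of automorphy of `L³` — in the fixed finite family `(f_c)`. This is
the instance `n = 3` of the classical fact that the products `∏ ϑ(z + aₖ)`, `Σ aₖ = 0`, lie in the
span of the `ϑ[c/n, 0](nz, nΩ)` (Mumford loc. cit.; it is what makes the level-`3` theta map of
Lefschetz's embedding theorem see all the functions `ϑ(z+a)ϑ(z+b)ϑ(z-a-b)` used in its proof,
Griffiths–Harris Ch. 2 §6). Proof: multiply out the three absolutely convergent series, reindex
`ℤ^{3g}` by `(c, q, u, v) ↦ (q + c - u - v, u + q, v + q)` (a bijection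
`{0,1,2}^g × ℤ^g × ℤ^g × ℤ^g ≃ ℤ^g × ℤ^g × ℤ^g`: `q = ⌊(m₁+m₂+m₃)/3⌋`, `c = (m₁+m₂+m₃) mod 3`), and
observe that in the new variables the exponent separates into a part in `(q, c, z)` and a part in
`(c, u, v, a, b)` (symmetry of `Ω`).

* `riemannThetaTerm_mul_mul_levelThree` — the pointwise factorisation of the general term;
* `levelThreeIndex_bijective` — the reindexing bijection;
* `riemannTheta_mul_mul_eq_sum_levelThree` — **the cubic product formula**;
* `differentiable_levelThree`, `levelThree_add_intCast`, `levelThree_add_mulVec` — the `f_c` are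
  entire, `ℤ^g`-periodic, and quasi-periodic for `Ωℤ^g` with the COMMON factor
  `exp(-3πi ᵗnΩn - 6πi ᵗn z)` (the factor of automorphy of `L³`);
* `exists_levelThree_family` — the whole package as one existential statement (a finite family of
  entire functions with common level-`3` automorphy through which all `ϑ(z+a)ϑ(z+b)ϑ(z-a-b)`
  factor), the form consumed by Lefschetz's theorem.

Everything is proved; no definitions, no named facts.

## References

* [MumfordTata1] D. Mumford, Tata Lectures on Theta I (1983), Ch. II §1 (pp. 118–124).
* [LangeBirkenhake1992] H. Lange, Ch. Birkenhake, Complex Abelian Varieties (1992), §3.2, §4.5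
  (Thm. 4.5.1), Remark 8.5.3.
* [GriffithsHarris1978] P. Griffiths, J. Harris, Principles of Algebraic Geometry (1978), Ch. 2 §6.
-/

noncomputable section

open Complex Real Finset Filter Topology Matrix

namespace Literature.Analysis.SpecialFunctions

variable {g : ℕ}

/-! ### Matrix form of the exponent -/

/-- `Σᵢ Σⱼ xᵢ Ωᵢⱼ yⱼ = ᵗx Ω y`. [folklore] -/
theorem sum_sum_mul_mul_eq_dotProduct_mulVec (Ω : Matrix (Fin g) (Fin g) ℂ) (x y : Fin g → ℂ) :
    ∑ i, ∑ j, x i * Ω i j * y j = x ⬝ᵥ (Ω *ᵥ y) := by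
  simp only [dotProduct, Matrix.mulVec, Finset.mul_sum, mul_assoc]

/-- The general term in matrix form: `exp(πi ᵗmΩm + 2πi ᵗm z)`. [folklore] -/
theorem riemannThetaTerm_eq_cexp_dotProduct (Ω : Matrix (Fin g) (Fin g) ℂ) (z : Fin g → ℂ)
    (m : Fin g → ℤ) :
    riemannThetaTerm Ω z m =
      cexp (π * I * ((fun i => (m i : ℂ)) ⬝ᵥ (Ω *ᵥ fun i => (m i : ℂ))) +
        2 * π * I * ((fun i => (m i : ℂ)) ⬝ᵥ z)) := by
  rw [riemannThetaTerm, sum_sum_mul_mul_eq_dotProduct_mulVec]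
  rfl

/-- `ᵗx Ω y = ᵗy Ω x` for symmetric `Ω`. [folklore] -/
theorem dotProduct_mulVec_comm_of_symm (Ω : Matrix (Fin g) (Fin g) ℂ) (hΩ : ∀ i j, Ω i j = Ω j i)
    (x y : Fin g → ℂ) : x ⬝ᵥ (Ω *ᵥ y) = y ⬝ᵥ (Ω *ᵥ x) := by
  have hT : Ωᵀ = Ω := by
    ext i j
    exact hΩ j i
  rw [Matrix.dotProduct_mulVec, ← Matrix.mulVec_transpose, hT, dotProduct_comm]

/-! ### The pointwise factorisation of the general term -/

/-- **The exponent separates in the variables `(q, c | u, v)`.** For symmetric `Ω`, integer vectors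
`q, u, v`, `c ∈ {0,1,2}^g` and `m₁ = q + c - u - v`, `m₂ = u + q`, `m₃ = v + q`:
`T_{z+a}(m₁) T_{z+b}(m₂) T_{z-a-b}(m₃) = [e^{2πi ᵗc z} T^{3Ω}_{3z+Ωc}(q)] · [T_a(c-u-v) T_b(u) T_{-a-b}(v)]`.
[cite: MumfordTata1, Ch. II §1 (pp. 122–124)] -/
theorem riemannThetaTerm_mul_mul_levelThree (Ω : Matrix (Fin g) (Fin g) ℂ)
    (hΩ : ∀ i j, Ω i j = Ω j i) (z a b : Fin g → ℂ) (c : Fin g → Fin 3) (q u v : Fin g → ℤ) :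
    riemannThetaTerm Ω (z + a) (fun i => q i + ((c i : ℕ) : ℤ) - u i - v i) *
        (riemannThetaTerm Ω (z + b) (u + q) * riemannThetaTerm Ω (z - a - b) (v + q)) =
      (cexp (2 * π * I * ((fun i => ((c i : ℕ) : ℂ)) ⬝ᵥ z)) *
          riemannThetaTerm ((3 : ℂ) • Ω)
            (fun i => 3 * z i + (Ω *ᵥ fun j => ((c j : ℕ) : ℂ)) i) q) *
        (riemannThetaTerm Ω a (fun i => ((c i : ℕ) : ℤ) - u i - v i) * riemannThetaTerm Ω b u *
          riemannThetaTerm Ω (-a - b) v) := by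
  simp only [riemannThetaTerm_eq_cexp_dotProduct, ← Complex.exp_add]
  congr 1
  -- name the complex vectors
  set Q : Fin g → ℂ := fun i => (q i : ℂ) with hQ
  set C : Fin g → ℂ := fun i => ((c i : ℕ) : ℂ) with hC
  set U : Fin g → ℂ := fun i => (u i : ℂ) with hU
  set V : Fin g → ℂ := fun i => (v i : ℂ) with hV
  have e1 : (fun i => (((fun i => q i + ((c i : ℕ) : ℤ) - u i - v i) i : ℤ) : ℂ)) = Q + C - U - V := by
    funext i
    simp [hQ, hC, hU, hV]
  have e2 : (fun i => (((u + q) i : ℤ) : ℂ)) = U + Q := by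
    funext i
    simp [hQ, hU]
  have e3 : (fun i => (((v + q) i : ℤ) : ℂ)) = V + Q := by
    funext i
    simp [hQ, hV]
  have e4 : (fun i => ((((c i : ℕ) : ℤ) - u i - v i : ℤ) : ℂ)) = C - U - V := by
    funext i
    simp [hC, hU, hV]
  have e5 : (fun i => 3 * z i + (Ω *ᵥ fun j => ((c j : ℕ) : ℂ)) i) = (3 : ℂ) • z + Ω *ᵥ C := by
    funext i
    simp [hC]
  rw [e1, e2, e3, e4, e5]
  simp only [add_dotProduct, sub_dotProduct, dotProduct_add, dotProduct_sub, dotProduct_neg,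
    Matrix.mulVec_add, Matrix.mulVec_sub, Matrix.smul_mulVec, dotProduct_smul, smul_eq_mul]
  have s := dotProduct_mulVec_comm_of_symm Ω hΩ
  rw [s C Q, s U Q, s V Q, s U C, s V C, s V U]
  ring

/-! ### The reindexing bijection -/

/-- **`(c, q, u, v) ↦ (q + c - u - v, u + q, v + q)` is a bijection
`{0,1,2}^g × ℤ^g × ℤ^g × ℤ^g ≃ ℤ^g × ℤ^g × ℤ^g`** (inverse: `s = m₁ + m₂ + m₃`, `q = ⌊s/3⌋`,
`c = s mod 3`, `u = m₂ - q`, `v = m₃ - q`). [folklore] -/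
theorem levelThreeIndex_bijective (g : ℕ) :
    Function.Bijective (fun x : (Fin g → Fin 3) × (Fin g → ℤ) × (Fin g → ℤ) × (Fin g → ℤ) =>
      ((fun i => x.2.1 i + ((x.1 i : ℕ) : ℤ) - x.2.2.1 i - x.2.2.2 i, x.2.2.1 + x.2.1,
        x.2.2.2 + x.2.1) : (Fin g → ℤ) × (Fin g → ℤ) × (Fin g → ℤ))) := by
  constructor
  · rintro ⟨c, q, u, v⟩ ⟨c', q', u', v'⟩ h
    simp only [Prod.mk.injEq] at h
    obtain ⟨h1, h2, h3⟩ := h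
    have key : ∀ i, q i = q' i ∧ (c i : ℕ) = (c' i : ℕ) := by
      intro i
      have e1 := congrFun h1 i
      have e2 := congrFun h2 i
      have e3 := congrFun h3 i
      simp only [Pi.add_apply] at e1 e2 e3
      have hc := (c i).isLt
      have hc' := (c' i).isLt
      omega
    have hq : q = q' := funext fun i => (key i).1
    have hcc : c = c' := funext fun i => Fin.ext (key i).2
    subst hq
    subst hcc
    have hu : u = u' := by
      funext i
      have := congrFun h2 i
      simp only [Pi.add_apply] at this
      omega
    have hv : v = v' := by
      funext i
      have := congrFun h3 i
      simp only [Pi.add_apply] at this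
      omega
    subst hu
    subst hv
    rfl
  · rintro ⟨m₁, m₂, m₃⟩
    refine ⟨(fun i => ⟨((m₁ i + m₂ i + m₃ i) % 3).toNat, by omega⟩,
      fun i => (m₁ i + m₂ i + m₃ i) / 3,
      fun i => m₂ i - (m₁ i + m₂ i + m₃ i) / 3, fun i => m₃ i - (m₁ i + m₂ i + m₃ i) / 3), ?_⟩
    simp only [Prod.mk.injEq]
    refine ⟨funext fun i => ?_, funext fun i => ?_, funext fun i => ?_⟩
    · show (m₁ i + m₂ i + m₃ i) / 3 + ((((m₁ i + m₂ i + m₃ i) % 3).toNat : ℕ) : ℤ) -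
          (m₂ i - (m₁ i + m₂ i + m₃ i) / 3) - (m₃ i - (m₁ i + m₂ i + m₃ i) / 3) = m₁ i
      omega
    · simp only [Pi.add_apply]
      omega
    · simp only [Pi.add_apply]
      omega

/-! ### Uniform bounds and summability -/

/-- The general term is bounded uniformly in `m`: `|T_ζ(m)| ≤ exp(g (2π|ζ|)²/(2πc))`. [folklore] -/
theorem norm_riemannThetaTerm_le_const (Ω : Matrix (Fin g) (Fin g) ℂ) {c : ℝ} (hc : 0 < c)
    (hY : ∀ x : Fin g → ℝ, c * ∑ i, x i ^ 2 ≤ ∑ i, ∑ j, x i * (Ω i j).im * x j)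
    (ζ : Fin g → ℂ) (m : Fin g → ℤ) :
    ‖riemannThetaTerm Ω ζ m‖ ≤ rexp (g * ((2 * π * ‖ζ‖) ^ 2 / (2 * (π * c)))) := by
  refine (norm_riemannThetaTerm_le Ω hc hY (R := ‖ζ‖) ζ
    (fun i => (Complex.abs_im_le_norm (ζ i)).trans (norm_le_pi_norm ζ i)) m).trans ?_
  refine mul_le_of_le_one_right (Real.exp_pos _).le ?_
  exact Finset.prod_le_one (fun i _ => (Real.exp_pos _).le) fun i _ =>
    Real.exp_le_one_iff.mpr (neg_nonpos.mpr (by positivity))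

/-- **The coefficient series `Λ_c(a, b) = Σ_{u,v} T_a(c-u-v) T_b(u) T_{-a-b}(v)` converges
absolutely.** [cite: MumfordTata1, Ch. II §1] -/
theorem summable_norm_levelThreeCoeff (Ω : Matrix (Fin g) (Fin g) ℂ) {c : ℝ} (hc : 0 < c)
    (hY : ∀ x : Fin g → ℝ, c * ∑ i, x i ^ 2 ≤ ∑ i, ∑ j, x i * (Ω i j).im * x j)
    (a b : Fin g → ℂ) (c₃ : Fin g → Fin 3) :
    Summable fun p : (Fin g → ℤ) × (Fin g → ℤ) =>
      ‖riemannThetaTerm Ω a (fun i => ((c₃ i : ℕ) : ℤ) - p.1 i - p.2 i) * riemannThetaTerm Ω b p.1 *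
        riemannThetaTerm Ω (-a - b) p.2‖ := by
  set K : ℝ := rexp (g * ((2 * π * ‖a‖) ^ 2 / (2 * (π * c)))) with hK
  have h2 : Summable fun p : (Fin g → ℤ) × (Fin g → ℤ) =>
      ‖riemannThetaTerm Ω b p.1 * riemannThetaTerm Ω (-a - b) p.2‖ :=
    (summable_norm_riemannThetaTerm Ω hc hY b).mul_norm (summable_norm_riemannThetaTerm Ω hc hY _)
  refine Summable.of_nonneg_of_le (fun _ => norm_nonneg _) (fun p => ?_) (h2.mul_left K)
  rw [mul_assoc, norm_mul]
  exact mul_le_mul_of_nonneg_right (norm_riemannThetaTerm_le_const Ω hc hY a _) (norm_nonneg _)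

/-- `Im(3Ω) ≥ 3c` when `Im Ω ≥ c`. [folklore] -/
theorem three_smul_im_bound (Ω : Matrix (Fin g) (Fin g) ℂ) {c : ℝ}
    (hY : ∀ x : Fin g → ℝ, c * ∑ i, x i ^ 2 ≤ ∑ i, ∑ j, x i * (Ω i j).im * x j) (x : Fin g → ℝ) :
    3 * c * ∑ i, x i ^ 2 ≤ ∑ i, ∑ j, x i * (((3 : ℂ) • Ω) i j).im * x j := by
  have h := hY x
  have e : ∑ i, ∑ j, x i * (((3 : ℂ) • Ω) i j).im * x j = 3 * ∑ i, ∑ j, x i * (Ω i j).im * x j := by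
    rw [Finset.mul_sum]
    refine Finset.sum_congr rfl fun i _ => ?_
    rw [Finset.mul_sum]
    refine Finset.sum_congr rfl fun j _ => ?_
    simp only [Matrix.smul_apply, smul_eq_mul, Complex.mul_im]
    norm_num
    ring
  rw [e]
  linarith

/-! ### The cubic product formula -/

/-- **The cubic product formula** (Mumford, Tata I, Ch. II §1; the case `n = 3` of "products of
translates of `ϑ` with translations summing to `0` lie in the span of the `ϑ[c/n,0](nz, nΩ)`"):
for symmetric `Ω` with `Im Ω ≥ c > 0` and all `z, a, b ∈ ℂ^g`,
`ϑ(z+a) ϑ(z+b) ϑ(z-a-b) = Σ_{c ∈ {0,1,2}^g} Λ_c(a,b) · e^{2πi ᵗc z} ϑ(3z + Ωc, 3Ω)` with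
`Λ_c(a,b) = Σ_{u,v} T_a(c-u-v) T_b(u) T_{-a-b}(v)`. [cite: MumfordTata1, Ch. II §1 (pp. 122–124)]
[cite: GriffithsHarris1978, Ch. 2 §6 (proof of the Lefschetz theorem)] -/
theorem riemannTheta_mul_mul_eq_sum_levelThree (Ω : Matrix (Fin g) (Fin g) ℂ)
    (hΩ : ∀ i j, Ω i j = Ω j i) {c : ℝ} (hc : 0 < c)
    (hY : ∀ x : Fin g → ℝ, c * ∑ i, x i ^ 2 ≤ ∑ i, ∑ j, x i * (Ω i j).im * x j)
    (z a b : Fin g → ℂ) :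
    riemannTheta Ω (z + a) * riemannTheta Ω (z + b) * riemannTheta Ω (z - a - b) =
      ∑ c₃ : Fin g → Fin 3,
        (∑' p : (Fin g → ℤ) × (Fin g → ℤ),
            riemannThetaTerm Ω a (fun i => ((c₃ i : ℕ) : ℤ) - p.1 i - p.2 i) *
              riemannThetaTerm Ω b p.1 * riemannThetaTerm Ω (-a - b) p.2) *
          (cexp (2 * π * I * ((fun i => ((c₃ i : ℕ) : ℂ)) ⬝ᵥ z)) *
            riemannTheta ((3 : ℂ) • Ω) (fun i => 3 * z i + (Ω *ᵥ fun j => ((c₃ j : ℕ) : ℂ)) i)) := by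
  -- Step 1: multiply out the three series
  have hn : ∀ ζ, Summable fun m => ‖riemannThetaTerm Ω ζ m‖ :=
    summable_norm_riemannThetaTerm Ω hc hY
  have h23n : Summable fun y : (Fin g → ℤ) × (Fin g → ℤ) =>
      ‖riemannThetaTerm Ω (z + b) y.1 * riemannThetaTerm Ω (z - a - b) y.2‖ :=
    Summable.mul_norm (f := riemannThetaTerm Ω (z + b)) (g := riemannThetaTerm Ω (z - a - b))
      (hn (z + b)) (hn (z - a - b))
  have h23 : (∑' m, riemannThetaTerm Ω (z + b) m) * (∑' m, riemannThetaTerm Ω (z - a - b) m) =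
      ∑' y : (Fin g → ℤ) × (Fin g → ℤ),
        riemannThetaTerm Ω (z + b) y.1 * riemannThetaTerm Ω (z - a - b) y.2 :=
    tsum_mul_tsum_of_summable_norm (f := riemannThetaTerm Ω (z + b))
      (g := riemannThetaTerm Ω (z - a - b)) (hn (z + b)) (hn (z - a - b))
  have h123 : (∑' m, riemannThetaTerm Ω (z + a) m) *
      (∑' y : (Fin g → ℤ) × (Fin g → ℤ),
        riemannThetaTerm Ω (z + b) y.1 * riemannThetaTerm Ω (z - a - b) y.2) =
      ∑' x : (Fin g → ℤ) × (Fin g → ℤ) × (Fin g → ℤ),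
        riemannThetaTerm Ω (z + a) x.1 *
          (riemannThetaTerm Ω (z + b) x.2.1 * riemannThetaTerm Ω (z - a - b) x.2.2) :=
    tsum_mul_tsum_of_summable_norm (f := riemannThetaTerm Ω (z + a))
      (g := fun y : (Fin g → ℤ) × (Fin g → ℤ) =>
        riemannThetaTerm Ω (z + b) y.1 * riemannThetaTerm Ω (z - a - b) y.2) (hn (z + a)) h23n
  have hPn : Summable fun x : (Fin g → ℤ) × (Fin g → ℤ) × (Fin g → ℤ) =>
      ‖riemannThetaTerm Ω (z + a) x.1 *
        (riemannThetaTerm Ω (z + b) x.2.1 * riemannThetaTerm Ω (z - a - b) x.2.2)‖ :=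
    Summable.mul_norm (f := riemannThetaTerm Ω (z + a))
      (g := fun y : (Fin g → ℤ) × (Fin g → ℤ) =>
        riemannThetaTerm Ω (z + b) y.1 * riemannThetaTerm Ω (z - a - b) y.2) (hn (z + a)) h23n
  rw [riemannTheta_def Ω (z + a), riemannTheta_def Ω (z + b), riemannTheta_def Ω (z - a - b),
    mul_assoc, h23, h123]
  -- Step 2: reindex by `(c, q, u, v) ↦ (q + c - u - v, u + q, v + q)`
  rw [← (Equiv.ofBijective _ (levelThreeIndex_bijective g)).tsum_eq]
  -- Step 3: the summand factors
  have hfac : ∀ x : (Fin g → Fin 3) × (Fin g → ℤ) × (Fin g → ℤ) × (Fin g → ℤ),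
      riemannThetaTerm Ω (z + a) ((Equiv.ofBijective _ (levelThreeIndex_bijective g)) x).1 *
        (riemannThetaTerm Ω (z + b) ((Equiv.ofBijective _ (levelThreeIndex_bijective g)) x).2.1 *
          riemannThetaTerm Ω (z - a - b)
            ((Equiv.ofBijective _ (levelThreeIndex_bijective g)) x).2.2) =
      (cexp (2 * π * I * ((fun i => ((x.1 i : ℕ) : ℂ)) ⬝ᵥ z)) *
          riemannThetaTerm ((3 : ℂ) • Ω)
            (fun i => 3 * z i + (Ω *ᵥ fun j => ((x.1 j : ℕ) : ℂ)) i) x.2.1) *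
        (riemannThetaTerm Ω a (fun i => ((x.1 i : ℕ) : ℤ) - x.2.2.1 i - x.2.2.2 i) *
          riemannThetaTerm Ω b x.2.2.1 * riemannThetaTerm Ω (-a - b) x.2.2.2) := by
    rintro ⟨c₃, q, u, v⟩
    simp only [Equiv.ofBijective_apply]
    exact riemannThetaTerm_mul_mul_levelThree Ω hΩ z a b c₃ q u v
  rw [tsum_congr hfac]
  -- summability of the reindexed family and of its pieces
  have hFs : Summable fun x : (Fin g → Fin 3) × (Fin g → ℤ) × (Fin g → ℤ) × (Fin g → ℤ) =>
      (cexp (2 * π * I * ((fun i => ((x.1 i : ℕ) : ℂ)) ⬝ᵥ z)) *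
          riemannThetaTerm ((3 : ℂ) • Ω)
            (fun i => 3 * z i + (Ω *ᵥ fun j => ((x.1 j : ℕ) : ℂ)) i) x.2.1) *
        (riemannThetaTerm Ω a (fun i => ((x.1 i : ℕ) : ℤ) - x.2.2.1 i - x.2.2.2 i) *
          riemannThetaTerm Ω b x.2.2.1 * riemannThetaTerm Ω (-a - b) x.2.2.2) := by
    have h1 := ((Equiv.ofBijective _ (levelThreeIndex_bijective g)).summable_iff
      (f := fun x : (Fin g → ℤ) × (Fin g → ℤ) × (Fin g → ℤ) =>
        riemannThetaTerm Ω (z + a) x.1 *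
          (riemannThetaTerm Ω (z + b) x.2.1 * riemannThetaTerm Ω (z - a - b) x.2.2))).mpr
      hPn.of_norm
    exact h1.congr hfac
  have hGs : ∀ c₃ : Fin g → Fin 3, Summable fun q : Fin g → ℤ =>
      cexp (2 * π * I * ((fun i => ((c₃ i : ℕ) : ℂ)) ⬝ᵥ z)) *
        riemannThetaTerm ((3 : ℂ) • Ω) (fun i => 3 * z i + (Ω *ᵥ fun j => ((c₃ j : ℕ) : ℂ)) i) q := by
    intro c₃
    refine Summable.mul_left _ ?_
    exact summable_riemannThetaTerm ((3 : ℂ) • Ω) (c := 3 * c) (by positivity)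
      (three_smul_im_bound Ω hY) _
  have hHs : ∀ c₃ : Fin g → Fin 3, Summable fun p : (Fin g → ℤ) × (Fin g → ℤ) =>
      riemannThetaTerm Ω a (fun i => ((c₃ i : ℕ) : ℤ) - p.1 i - p.2 i) * riemannThetaTerm Ω b p.1 *
        riemannThetaTerm Ω (-a - b) p.2 := fun c₃ =>
    (summable_norm_levelThreeCoeff Ω hc hY a b c₃).of_norm
  -- Step 4: sum over `c` first (finite), then split the product of the two inner series
  rw [hFs.tsum_prod' (fun c₃ => hFs.prod_factor c₃), tsum_fintype]
  refine Finset.sum_congr rfl fun c₃ _ => ?_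
  rw [← (hGs c₃).tsum_mul_tsum (hHs c₃) (hFs.prod_factor c₃)]
  -- Step 5: `Σ_q G c q = e^{2πi ᵗc z} ϑ(3z + Ωc, 3Ω)`
  rw [tsum_mul_left, riemannTheta_def]
  ring

/-! ### The level-three theta functions: holomorphy and automorphy -/

/-- `f_c(z) = e^{2πi ᵗc z} ϑ(3z + Ωc, 3Ω)` is entire. [cite: MumfordTata1, Ch. II §1] -/
theorem differentiable_levelThree (Ω : Matrix (Fin g) (Fin g) ℂ) {c : ℝ} (hc : 0 < c)
    (hY : ∀ x : Fin g → ℝ, c * ∑ i, x i ^ 2 ≤ ∑ i, ∑ j, x i * (Ω i j).im * x j)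
    (c₃ : Fin g → Fin 3) :
    Differentiable ℂ fun z : Fin g → ℂ =>
      cexp (2 * π * I * ((fun i => ((c₃ i : ℕ) : ℂ)) ⬝ᵥ z)) *
        riemannTheta ((3 : ℂ) • Ω) (fun i => 3 * z i + (Ω *ᵥ fun j => ((c₃ j : ℕ) : ℂ)) i) := by
  have h3 : Differentiable ℂ (riemannTheta ((3 : ℂ) • Ω)) :=
    differentiable_riemannTheta ((3 : ℂ) • Ω) (c := 3 * c) (by positivity) (three_smul_im_bound Ω hY)
  have hlin : Differentiable ℂ fun y : Fin g → ℂ => ∑ i, ((c₃ i : ℕ) : ℂ) * y i := by fun_prop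
  refine Differentiable.mul ?_ (h3.comp ?_)
  · exact (hlin.const_mul (2 * π * I)).cexp
  · exact differentiable_pi.mpr fun i => by fun_prop

/-- `e^{2πi ᵗc n} = 1` for integer vectors. [folklore] -/
theorem cexp_two_pi_I_natCast_dotProduct_intCast (c₃ : Fin g → Fin 3) (n : Fin g → ℤ) :
    cexp (2 * π * I * ((fun i => ((c₃ i : ℕ) : ℂ)) ⬝ᵥ fun i => (n i : ℂ))) = 1 := by
  have h : ((fun i => ((c₃ i : ℕ) : ℂ)) ⬝ᵥ fun i => (n i : ℂ)) = ((∑ i, ((c₃ i : ℕ) : ℤ) * n i : ℤ) : ℂ) := by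
    simp only [dotProduct]
    push_cast
    rfl
  rw [h, show 2 * (π : ℂ) * I * ((∑ i, ((c₃ i : ℕ) : ℤ) * n i : ℤ) : ℂ) =
    ((∑ i, ((c₃ i : ℕ) : ℤ) * n i : ℤ) : ℂ) * (2 * π * I) by ring]
  exact Complex.exp_int_mul_two_pi_mul_I _

/-- **Periodicity**: `f_c(z + n) = f_c(z)` for `n ∈ ℤ^g`. [cite: MumfordTata1, Ch. II §1] -/
theorem levelThree_add_intCast (Ω : Matrix (Fin g) (Fin g) ℂ) (c₃ : Fin g → Fin 3)
    (z : Fin g → ℂ) (n : Fin g → ℤ) :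
    cexp (2 * π * I * ((fun i => ((c₃ i : ℕ) : ℂ)) ⬝ᵥ fun i => z i + n i)) *
        riemannTheta ((3 : ℂ) • Ω)
          (fun i => 3 * (z i + n i) + (Ω *ᵥ fun j => ((c₃ j : ℕ) : ℂ)) i) =
      cexp (2 * π * I * ((fun i => ((c₃ i : ℕ) : ℂ)) ⬝ᵥ z)) *
        riemannTheta ((3 : ℂ) • Ω) (fun i => 3 * z i + (Ω *ᵥ fun j => ((c₃ j : ℕ) : ℂ)) i) := by
  congr 1
  · have e : ((fun i => ((c₃ i : ℕ) : ℂ)) ⬝ᵥ fun i => z i + n i) =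
        (fun i => ((c₃ i : ℕ) : ℂ)) ⬝ᵥ z + (fun i => ((c₃ i : ℕ) : ℂ)) ⬝ᵥ fun i => (n i : ℂ) := by
      rw [← dotProduct_add]
      rfl
    rw [e, mul_add, Complex.exp_add, cexp_two_pi_I_natCast_dotProduct_intCast, mul_one]
  · have e : (fun i => 3 * (z i + n i) + (Ω *ᵥ fun j => ((c₃ j : ℕ) : ℂ)) i) =
        fun i => (3 * z i + (Ω *ᵥ fun j => ((c₃ j : ℕ) : ℂ)) i) + ((3 * n i : ℤ) : ℂ) := by
      funext i
      push_cast
      ring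
    rw [e]
    exact riemannTheta_add_intCast ((3 : ℂ) • Ω) _ (fun i => 3 * n i)

/-- **Quasi-periodicity with the factor of automorphy of `L³`**: for symmetric `Ω` and `n ∈ ℤ^g`,
`f_c(z + Ωn) = exp(-3πi ᵗnΩn - 6πi ᵗn z) f_c(z)` — the SAME factor for every `c`.
[cite: MumfordTata1, Ch. II §1] [cite: LangeBirkenhake1992, §3.2] -/
theorem levelThree_add_mulVec (Ω : Matrix (Fin g) (Fin g) ℂ) (hΩ : ∀ i j, Ω i j = Ω j i)
    (c₃ : Fin g → Fin 3) (z : Fin g → ℂ) (n : Fin g → ℤ) :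
    cexp (2 * π * I * ((fun i => ((c₃ i : ℕ) : ℂ)) ⬝ᵥ fun i => z i + ∑ j, Ω i j * (n j : ℂ))) *
        riemannTheta ((3 : ℂ) • Ω)
          (fun i => 3 * (z i + ∑ j, Ω i j * (n j : ℂ)) + (Ω *ᵥ fun j => ((c₃ j : ℕ) : ℂ)) i) =
      cexp (3 * (-(π * I * ∑ i, ∑ j, (n i : ℂ) * Ω i j * (n j : ℂ)) -
          2 * π * I * ∑ i, (n i : ℂ) * z i)) *
        (cexp (2 * π * I * ((fun i => ((c₃ i : ℕ) : ℂ)) ⬝ᵥ z)) *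
          riemannTheta ((3 : ℂ) • Ω) (fun i => 3 * z i + (Ω *ᵥ fun j => ((c₃ j : ℕ) : ℂ)) i)) := by
  have h3Ω : ∀ i j, ((3 : ℂ) • Ω) i j = ((3 : ℂ) • Ω) j i := fun i j => by
    simp only [Matrix.smul_apply, hΩ i j]
  -- the argument of `ϑ(·, 3Ω)` is shifted by `(3Ω) n`
  have e : (fun i => 3 * (z i + ∑ j, Ω i j * (n j : ℂ)) + (Ω *ᵥ fun j => ((c₃ j : ℕ) : ℂ)) i) =
      fun i => (3 * z i + (Ω *ᵥ fun j => ((c₃ j : ℕ) : ℂ)) i) + ∑ j, ((3 : ℂ) • Ω) i j * (n j : ℂ) := by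
    funext i
    simp only [Matrix.smul_apply, smul_eq_mul, mul_assoc]
    rw [← Finset.mul_sum]
    ring
  rw [e, riemannTheta_add_mulVec ((3 : ℂ) • Ω) h3Ω _ n]
  -- compare the exponential factors
  set C : Fin g → ℂ := fun i => ((c₃ i : ℕ) : ℂ) with hC
  set N : Fin g → ℂ := fun i => (n i : ℂ) with hN
  have e1 : ((fun i => ((c₃ i : ℕ) : ℂ)) ⬝ᵥ fun i => z i + ∑ j, Ω i j * (n j : ℂ)) =
      C ⬝ᵥ z + C ⬝ᵥ (Ω *ᵥ N) := by
    rw [← dotProduct_add]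
    rfl
  have e2 : ∑ i, ∑ j, (n i : ℂ) * ((3 : ℂ) • Ω) i j * (n j : ℂ) = 3 * (N ⬝ᵥ (Ω *ᵥ N)) := by
    rw [← sum_sum_mul_mul_eq_dotProduct_mulVec, Finset.mul_sum]
    refine Finset.sum_congr rfl fun i _ => ?_
    rw [Finset.mul_sum]
    refine Finset.sum_congr rfl fun j _ => ?_
    simp only [Matrix.smul_apply, smul_eq_mul, hN]
    ring
  have e3 : ∑ i, (n i : ℂ) * (3 * z i + (Ω *ᵥ fun j => ((c₃ j : ℕ) : ℂ)) i) =
      3 * (N ⬝ᵥ z) + N ⬝ᵥ (Ω *ᵥ C) := by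
    simp only [dotProduct, Finset.mul_sum, ← Finset.sum_add_distrib, hN, hC]
    refine Finset.sum_congr rfl fun i _ => ?_
    ring
  have e4 : ∑ i, ∑ j, (n i : ℂ) * Ω i j * (n j : ℂ) = N ⬝ᵥ (Ω *ᵥ N) :=
    sum_sum_mul_mul_eq_dotProduct_mulVec Ω N N
  have e5 : ∑ i, (n i : ℂ) * z i = N ⬝ᵥ z := rfl
  rw [e1, e2, e3, e4, e5, dotProduct_mulVec_comm_of_symm Ω hΩ N C]
  rw [← mul_assoc (cexp _) (cexp _), ← mul_assoc (cexp _) (cexp _), ← Complex.exp_add,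
    ← Complex.exp_add]
  congr 2
  ring

/-! ### The package consumed by Lefschetz's theorem -/

/-- **The level-three theta family.** For symmetric `Ω` with `Im Ω ≥ c > 0` there is a finite family
`(f_c)_{c ∈ {0,1,2}^g}` of entire functions on `ℂ^g`, `ℤ^g`-periodic and with the common
quasi-periodicity `f_c(z + Ωn) = exp(-3πi ᵗnΩn - 6πi ᵗn z) f_c(z)` (`n ∈ ℤ^g`), such that every
product `ϑ(z+a)ϑ(z+b)ϑ(z-a-b)` is a `ℂ`-linear combination `Σ_c Λ_c(a,b) f_c(z)` of them with
coefficients independent of `z` — namely `f_c(z) = e^{2πi ᵗc z} ϑ(3z + Ωc, 3Ω)`.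
[cite: MumfordTata1, Ch. II §1 (pp. 118–124)] [cite: GriffithsHarris1978, Ch. 2 §6] -/
theorem exists_levelThree_family (Ω : Matrix (Fin g) (Fin g) ℂ) (hΩ : ∀ i j, Ω i j = Ω j i)
    {c : ℝ} (hc : 0 < c)
    (hY : ∀ x : Fin g → ℝ, c * ∑ i, x i ^ 2 ≤ ∑ i, ∑ j, x i * (Ω i j).im * x j) :
    ∃ f : (Fin g → Fin 3) → (Fin g → ℂ) → ℂ,
      (∀ c₃, Differentiable ℂ (f c₃)) ∧
      (∀ c₃ (z : Fin g → ℂ) (n : Fin g → ℤ), f c₃ (fun i => z i + n i) = f c₃ z) ∧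
      (∀ c₃ (z : Fin g → ℂ) (n : Fin g → ℤ),
        f c₃ (fun i => z i + ∑ j, Ω i j * (n j : ℂ)) =
          cexp (3 * (-(π * I * ∑ i, ∑ j, (n i : ℂ) * Ω i j * (n j : ℂ)) -
            2 * π * I * ∑ i, (n i : ℂ) * z i)) * f c₃ z) ∧
      (∀ a b : Fin g → ℂ, ∃ Λ : (Fin g → Fin 3) → ℂ, ∀ z : Fin g → ℂ,
        riemannTheta Ω (z + a) * riemannTheta Ω (z + b) * riemannTheta Ω (z - a - b) =
          ∑ c₃, Λ c₃ * f c₃ z) := by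
  refine ⟨fun c₃ z => cexp (2 * π * I * ((fun i => ((c₃ i : ℕ) : ℂ)) ⬝ᵥ z)) *
      riemannTheta ((3 : ℂ) • Ω) (fun i => 3 * z i + (Ω *ᵥ fun j => ((c₃ j : ℕ) : ℂ)) i),
    fun c₃ => differentiable_levelThree Ω hc hY c₃,
    fun c₃ z n => levelThree_add_intCast Ω c₃ z n,
    fun c₃ z n => levelThree_add_mulVec Ω hΩ c₃ z n,
    fun a b => ⟨fun c₃ => ∑' p : (Fin g → ℤ) × (Fin g → ℤ),
      riemannThetaTerm Ω a (fun i => ((c₃ i : ℕ) : ℤ) - p.1 i - p.2 i) *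
        riemannThetaTerm Ω b p.1 * riemannThetaTerm Ω (-a - b) p.2,
      fun z => riemannTheta_mul_mul_eq_sum_levelThree Ω hΩ hc hY z a b⟩⟩

end Literature.Analysis.SpecialFunctions

end
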